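/-
Copyright: H21 programme, solo seat `solo-RiemannHypothesis-informed` (session 6).
-/
import Summits.RiemannHypothesis.RiemannHypothesis.Theorems.SoloInformedTuranVisibility

/-!
# Turán visibility is sharp in shape (solo-informed, T39♭)

The constant `c(n, τ₀) = turanConst n τ₀` of `exists_norm_expSum_ge_of_weights` (a lower bound
for `max_{τ ∈ [τ₀, τ₀+1]} |Σ b_j w_j e^{λ_j τ}|` in terms of the leading weight) cannot beat
`(π/k)^{n}` for `n + 1` nodes and `τ₀ = k`: the binomial sum
`Σ_j C(n,j) e^{i j (π/k) τ} = (1 + e^{iπτ/k})^{n}` has modulus `(2|cos(πτ/(2k))|)^{n} ≤ (π/k)^{n}`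
on `[k, k+1]` (`turan_binomial_small`), while its `j = 0` weight is `1`.  Hence
`turanConst (n+1) k ≤ (π/k)^n` (`turanConst_le_pow`): pricing companions by Turán's theorem costs
at least `log(k/π)` per companion on an interval that is the fraction `1/(k+1)` of its endpoint —
the tariff of T39/T39♯ is sharp in shape within the method (companions equally spaced at height
distance `π/k·(scale)` with binomial weights realise it).
-/

noncomputable section

open Real Complex Set
open scoped ComplexConjugate

namespace Summit.RiemannHypothesis.RiemannHypothesis.Theorems

/-- `|1 + e^{iθ}| = 2|cos(θ/2)|`. -/
theorem norm_one_add_cexp_mul_I (θ : ℝ) : ‖1 + cexp (θ * I)‖ = 2 * |Real.cos (θ / 2)| := by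
  have h1 : ‖1 + cexp (θ * I)‖ ^ 2 = (2 * |Real.cos (θ / 2)|) ^ 2 := by
    rw [mul_pow, sq_abs, Complex.sq_norm, Complex.normSq_apply, Complex.add_re, Complex.add_im,
      Complex.exp_ofReal_mul_I_re, Complex.exp_ofReal_mul_I_im, Complex.one_re, Complex.one_im]
    have hc := Real.cos_sq (θ / 2)
    rw [show 2 * (θ / 2) = θ by ring] at hc
    nlinarith [Real.sin_sq_add_cos_sq θ]
  exact (pow_left_inj₀ (norm_nonneg _) (by positivity) two_ne_zero).mp h1

/-- The binomial exponential sum: `Σ_{j ≤ n} C(n,j) e^{(i j δ) τ} = (1 + e^{i δ τ})^n`. -/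
theorem binomial_expSum (n : ℕ) (δ τ : ℝ) :
    ∑ j ∈ Finset.range (n + 1), ((n.choose j : ℝ) : ℂ) * cexp ((j * δ * I : ℂ) * τ) =
      (1 + cexp (δ * τ * I)) ^ n := by
  rw [show (1 : ℂ) + cexp (δ * τ * I) = cexp (δ * τ * I) + 1 from add_comm _ _, add_pow]
  refine Finset.sum_congr rfl fun j _ ↦ ?_
  rw [one_pow, mul_one, mul_comm, ← Complex.exp_nat_mul]
  push_cast
  ring_nf

/-- On `[k, k+1]` the binomial sum with `δ = π/k` is at most `(π/k)^n` in modulus. -/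
theorem turan_binomial_small (n : ℕ) {k : ℕ} (hk : 1 ≤ k) {τ : ℝ} (hτ : τ ∈ Icc (k : ℝ) (k + 1)) :
    ‖∑ j ∈ Finset.range (n + 1), ((n.choose j : ℝ) : ℂ) * cexp ((j * (π / k) * I : ℂ) * τ)‖ ≤
      (π / k) ^ n := by
  have hkpos : (0 : ℝ) < k := by exact_mod_cast hk
  have h := binomial_expSum n (π / k) τ
  push_cast at h ⊢
  rw [h, norm_pow, show (↑π / ↑k * ↑τ * I : ℂ) = ((π / k * τ : ℝ) : ℂ) * I by push_cast; ring,
    norm_one_add_cexp_mul_I]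
  refine pow_le_pow_left₀ (by positivity) ?_ n
  -- `π τ/(2k) = π/2 + s` with `0 ≤ s ≤ π/(2k)`, and `|cos(π/2 + s)| = |sin s| ≤ s`
  set s : ℝ := π / k * τ / 2 - π / 2 with hs
  have hs0 : 0 ≤ s := by
    rw [hs]; have : π / k * k ≤ π / k * τ := mul_le_mul_of_nonneg_left hτ.1 (by positivity)
    rw [div_mul_cancel₀ _ hkpos.ne'] at this; linarith
  have hs1 : s ≤ π / (2 * k) := by
    rw [hs]
    have : π / k * τ ≤ π / k * (k + 1) := mul_le_mul_of_nonneg_left hτ.2 (by positivity)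
    rw [mul_add, div_mul_cancel₀ _ hkpos.ne', mul_one] at this
    have e : π / (2 * k) = π / k / 2 := by rw [div_div, mul_comm]
    rw [e]; linarith
  have e : π / k * τ / 2 = s + π / 2 := by rw [hs]; ring
  rw [e, Real.cos_add_pi_div_two, abs_neg]  -- cos(s + π/2) = -sin s
  calc 2 * |Real.sin s| ≤ 2 * s := by
        rw [abs_of_nonneg (Real.sin_nonneg_of_nonneg_of_le_pi hs0 (by
          have : π / (2 * k) ≤ π := by
            rw [div_le_iff₀ (by positivity)]
            have hk1 : (1 : ℝ) ≤ k := by exact_mod_cast hk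
            nlinarith [Real.pi_pos, hk1]
          linarith))]
        linarith [Real.sin_le hs0]
    _ ≤ π / k := by
        have e2 : π / k = 2 * (π / (2 * k)) := by field_simp
        rw [e2]; linarith

/-- **Turán's constant is at most `(π/k)^n` for `n+1` nodes at `τ₀ = k`.**  (Binomial weights,
nodes `i j π/k`, all real parts equal, leading weight `b₀ = 1`, exact multipliers.) -/
theorem turanConst_le_pow (n : ℕ) {k : ℕ} (hk : 1 ≤ k) : turanConst (n + 1) k ≤ (π / k) ^ n := by
  classical
  have hkpos : (0 : ℝ) < k := by exact_mod_cast hk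
  set lam : ℕ → ℂ := fun j ↦ (j * (π / k) * I : ℂ) with hlam
  set b : ℕ → ℝ := fun j ↦ (n.choose j : ℝ) with hb
  have hre : ∀ j, (lam j).re = 0 := fun j ↦ by simp [hlam]
  obtain ⟨τ, hτ, hT⟩ := exists_norm_expSum_ge_of_weights (Finset.range (n + 1)) lam b
    (fun j _ ↦ by positivity) (j₀ := 0) (by simp) (fun j _ ↦ by rw [hre, hre])
    (τ₀ := (k : ℝ)) hkpos.le (fun _ ↦ (1 : ℂ)) (ε := 0) (fun _ _ ↦ by simp)
  have hb0 : b 0 = 1 := by simp [hb]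
  simp only [Finset.card_range, hre, zero_mul, Real.exp_zero, mul_one, sub_zero, hb0,
    one_mul] at hT
  exact hT.trans (turan_binomial_small n hk hτ)

end Summit.RiemannHypothesis.RiemannHypothesis.Theorems
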